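import Summits.MatrixMultiplication.MatrixMultiplication.Theses.TropicalBiniPatterns

/-!
# `TropicalBiniPatterns.Assembly` (stmt-MatrixMultiplication-8013) — proved

The assembly item of route `MatrixMultiplication/TropicalBiniPatterns` is the implication
`BorderCertificateFamily → MatrixMultiplication`: the Schönhage border-certificate family
(for every `ε > 0` a direct sum `D = ⊕_{i<p} ⟨kᵢ,mᵢ,nᵢ⟩` of matrix products, `p ≥ 1`, every block
of volume `kᵢmᵢnᵢ ≥ 2`, and an `r` with `bR(D) ≤ r ≤ ∑ᵢ (kᵢmᵢnᵢ)^{(2+ε)/3}`, `bR` = the algebraic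
border rank over `ℂ[ε]`) gives `ω(ℂ) = 2`.

Proof (self-contained real-analysis bookkeeping; it follows — but does not invoke — the route
file's deciding theorem `closes`).  `ω(ℂ) ≥ 2` is the flattening frame `omega_two_le ℂ`.  For
`ω(ℂ) ≤ 2` it suffices (`le_of_forall_pos_le_add`) to show `ω ≤ 2 + ε` for every `ε > 0`: the
hypothesis supplies `D` and `r`, Schönhage's asymptotic sum inequality for the BORDER rank,
`asymptoticSumInequality_algBorderRank` (proved in `SchoenhageTauDischarge.lean`), gives
`∑ᵢ (kᵢmᵢnᵢ)^{ω/3} ≤ r ≤ ∑ᵢ (kᵢmᵢnᵢ)^{(2+ε)/3}`; were `ω > 2 + ε`, every summand on the right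
would be strictly below the matching one on the left (`kᵢmᵢnᵢ ≥ 2 > 1`,
`Real.rpow_lt_rpow_of_exponent_lt`) over the non-empty index set `Fin p`
(`Finset.sum_lt_sum_of_nonempty`) — a contradiction.
-/

-- single-conjunct summit: the mandated namespace `Summit.MatrixMultiplication.MatrixMultiplication.…`
-- repeats `MatrixMultiplication` (summit = sub-problem), which `linter.dupNamespace` would flag.
set_option linter.dupNamespace false

namespace Summit.MatrixMultiplication.MatrixMultiplication.Theorems

open scoped BigOperators
open Literature.Computability.AlgebraicComplexity

/-- **Assembly of route `TropicalBiniPatterns` (stmt-MatrixMultiplication-8013), exact signature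
`BorderCertificateFamily → MatrixMultiplication`.**  A border-certificate family
`bR(⊕ᵢ⟨kᵢ,mᵢ,nᵢ⟩) ≤ r ≤ ∑ᵢ (kᵢmᵢnᵢ)^{(2+ε)/3}` for every `ε > 0` forces `ω(ℂ) ≤ 2 + ε` by the
border-rank asymptotic sum inequality `∑ᵢ (kᵢmᵢnᵢ)^{ω/3} ≤ r` and strict monotonicity of
`x ↦ a^x` for `a ≥ 2`; with `2 ≤ ω(ℂ)` (`omega_two_le`) this is `ω(ℂ) = 2`.
(Schönhage 1981, the `τ`-theorem, in Bläser's border-rank form.) [cite: Blaser2013, Thm. 7.5] -/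
theorem tropicalBiniPatterns_assembly_proof :
    Summit.MatrixMultiplication.MatrixMultiplication.Theses.TropicalBiniPatterns.Assembly := by
  unfold Summit.MatrixMultiplication.MatrixMultiplication.Theses.TropicalBiniPatterns.Assembly
    Summit.MatrixMultiplication.MatrixMultiplication.Theses.TropicalBiniPatterns.BorderCertificateFamily
  intro hX
  show omega ℂ = 2
  refine le_antisymm (le_of_forall_pos_le_add fun ε hε => ?_) (omega_two_le ℂ)
  obtain ⟨p, k, m, n, r, hp, hkmn, hR, hr⟩ := hX ε hε
  have hASI := asymptoticSumInequality_algBorderRank ℂ k m n hR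
  by_contra hlt
  rw [not_le] at hlt
  have hne : (Finset.univ : Finset (Fin p)).Nonempty := ⟨⟨0, hp⟩, Finset.mem_univ _⟩
  have hsum : ∑ i, ((k i * m i * n i : ℕ) : ℝ) ^ ((2 + ε) / 3) <
      ∑ i, ((k i * m i * n i : ℕ) : ℝ) ^ (omega ℂ / 3) :=
    Finset.sum_lt_sum_of_nonempty hne fun i _ =>
      Real.rpow_lt_rpow_of_exponent_lt (by exact_mod_cast (hkmn i : 1 < k i * m i * n i))
        (by linarith)
  linarith

end Summit.MatrixMultiplication.MatrixMultiplication.Theorems
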